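import Literature.NumberTheory.Transcendental.LaurentInterpolationDeterminant
import HarnessLib

/-!
# Transcendence measure for `e` (Nesterenko–Waldschmidt 1996) — IV: the analytic upper bound

Topic `Literature/NumberTheory/Transcendental`; sibling proof file of
`ExpOneTranscendenceMeasure.lean` (the named fact
`Literature.NumberTheory.Transcendental.NesterenkoWaldschmidt1996_thm_4_2`). Everything here is
PROVED; no definitions, no named facts.

This part is Lemma 3 of [NesterenkoWaldschmidt1996, §3], the analytic upper bound for Laurent's
interpolation determinants WITH DERIVATIVES AND A PERTURBATION: for entire `φ_λ`, points `ζ_μ`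
(`|ζ_μ| ≤ r`), orders `σ_μ`, `E ≥ 1`, perturbations `|p_{μλ}| ≤ ε 𝔐` with `ε E^L ≤ 1`, and
`|φ_λ^{(σ_μ)}(z)| ≤ 𝔐` on `|z| ≤ E r`,

  `|det (φ_λ^{(σ_μ)}(ζ_μ) + p_{μλ})| ≤ 2^L · L! · 𝔐^L · E^{∑ σ_μ} / E^{L(L-1)/2}`

(`NW1996.norm_det_interpolation_deriv_le`; the printed form is
`L⁻¹ log|𝒟| ≤ -½L log E + M + S log E + log(2LE)`).

Proof as printed (p. 3 of the arXiv version), organised as in the tree's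
`LaurentInterpolationDeterminant` (the case `σ = 0`, `p = 0`): expand the determinant by
multilinearity in the columns into `2^L` determinants `𝒟_I` whose columns `λ ∉ I` are the constant
perturbation columns (`MultilinearMap.map_add_univ`); `𝒟_I(z) = det(φ_λ^{(σ_μ)}(zζ_μ) | p)` is entire
and vanishes at `0` to order `≥ |I|(|I|-1)/2 - ∑σ_μ`: its derivatives are sums of determinants
whose structured columns at `z = 0` are `(ζ_μ^{k_μ} φ_λ^{(σ_μ+k_μ)}(0))_μ`, and such a determinant
vanishes as soon as `μ ↦ σ_μ + k_μ` takes fewer than `|I|` values (the `|I|` structured columns are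
then linearly dependent — this replaces the Laplace expansion along the constant rows of the
printed proof); the Schwarz lemma on `|z| = E` (`Baker1975.Analytic.norm_le_of_analyticOrderAt`) and
the crude bound `|det| ≤ L! ∏ (column bounds)` finish, the hypothesis `ε ≤ E^{-L}` making every
term at most `E^{∑σ - L(L-1)/2} L! 𝔐^L`.

## References

* [NesterenkoWaldschmidt1996] Yu. V. Nesterenko, M. Waldschmidt, *On the approximation of the values
  of exponential function and logarithm by algebraic numbers*, Mat. Zapiski 2 (1996), 23–42;
  arXiv:math/0002047, §3 Lemma 3.
* M. Laurent, *Linear forms in two logarithms and interpolation determinants*, Acta Arith. 66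
  (1994), 181–199 (not held; quoted after the tree's `LaurentInterpolationDeterminant`).
-/

noncomputable section

open Complex Finset Metric

namespace Literature.NumberTheory.Transcendental

namespace NW1996

variable {κ : Type*} [Fintype κ] [DecidableEq κ]

/-! ### Determinants of differentiated entries -/

section General

variable {g : κ → κ → ℂ → ℂ}

/-- The derivative of `w ↦ det (∂^{k_i} g_{ij}(w))` is `∑_{i₀} det (∂^{k_i + [i = i₀]} g_{ij}(w))`
(multilinearity in the rows). [folklore] -/
theorem hasDerivAt_detDeriv (hg : ∀ i j, Differentiable ℂ (g i j)) (k : κ → ℕ) (z : ℂ) :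
    HasDerivAt (fun w => Matrix.det (Matrix.of fun i j => iteratedDeriv (k i) (g i j) w))
      (∑ i₀, Matrix.det (Matrix.of fun i j =>
        iteratedDeriv ((k + Pi.single i₀ 1 : κ → ℕ) i) (g i j) z)) z := by
  have h := Laurent.hasDerivAt_det (ι := κ)
    (A := fun i j w => iteratedDeriv (k i) (g i j) w)
    (A' := fun i j w => iteratedDeriv (k i + 1) (g i j) w) (z := z)
    (fun i j => by
      have hd := ((((hg i j).contDiff (n := ⊤)).differentiable_iteratedDeriv (k i)
        (WithTop.coe_lt_top _)) z).hasDerivAt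
      rwa [← congrFun (iteratedDeriv_succ (n := k i) (f := g i j)) z] at hd)
  refine h.congr_deriv (Finset.sum_congr rfl fun i₀ _ => ?_)
  congr 1
  ext i j
  simp only [Matrix.of_apply, Pi.add_apply, Pi.single_apply]
  split_ifs with hi
  · subst hi; rfl
  · simp

/-- `w ↦ det (∂^{k_i} g_{ij}(w))` is entire. [folklore] -/
theorem differentiable_detDeriv (hg : ∀ i j, Differentiable ℂ (g i j)) (k : κ → ℕ) :
    Differentiable ℂ (fun w => Matrix.det (Matrix.of fun i j => iteratedDeriv (k i) (g i j) w)) :=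
  fun z => (hasDerivAt_detDeriv hg k z).differentiableAt

/-- All derivatives of `w ↦ det (∂^{k_i} g_{ij}(w))` at `0` vanish as long as `∑ k_i + n < B`,
provided every `det (∂^{k_i} g_{ij}(0))` with `∑ k_i < B` vanishes. [folklore] -/
theorem iteratedDeriv_detDeriv_eq_zero (hg : ∀ i j, Differentiable ℂ (g i j)) (B : ℕ)
    (hbase : ∀ k : κ → ℕ, (∑ i, k i) < B →
      Matrix.det (Matrix.of fun i j => iteratedDeriv (k i) (g i j) 0) = 0) :
    ∀ (n : ℕ) (k : κ → ℕ), (∑ i, k i) + n < B →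
      iteratedDeriv n (fun w => Matrix.det (Matrix.of fun i j => iteratedDeriv (k i) (g i j) w)) 0 = 0 := by
  intro n
  induction n with
  | zero => intro k hk; simpa using hbase k (by simpa using hk)
  | succ n ih =>
    intro k hk
    rw [iteratedDeriv_succ', funext fun z => (hasDerivAt_detDeriv hg k z).deriv,
      iteratedDeriv_fun_sum (fun i _ => ((differentiable_detDeriv hg _).contDiff).contDiffAt)]
    refine Finset.sum_eq_zero fun i _ => ih _ ?_
    have : ∑ x, (k + Pi.single i 1 : κ → ℕ) x = (∑ x, k x) + 1 := by
      simp [Finset.sum_add_distrib, Finset.sum_pi_single']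
    omega

/-- Hence `w ↦ det (g_{ij}(w))` vanishes at `0` to order `≥ B`. [folklore] -/
theorem le_analyticOrderAt_det (hg : ∀ i j, Differentiable ℂ (g i j)) (B : ℕ)
    (hbase : ∀ k : κ → ℕ, (∑ i, k i) < B →
      Matrix.det (Matrix.of fun i j => iteratedDeriv (k i) (g i j) 0) = 0) :
    (B : ℕ∞) ≤ analyticOrderAt (fun w => Matrix.det (Matrix.of fun i j => g i j w)) 0 := by
  have hD := differentiable_detDeriv hg 0
  have h0 : (fun w => Matrix.det (Matrix.of fun i j => iteratedDeriv ((0 : κ → ℕ) i) (g i j) w)) =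
      fun w => Matrix.det (Matrix.of fun i j => g i j w) := by
    funext w; simp
  rw [← h0]
  refine Baker1975.Analytic.le_analyticOrderAt_of_iteratedDeriv_eq_zero hD fun m hm => ?_
  exact iteratedDeriv_detDeriv_eq_zero hg B hbase m 0 (by simpa using hm)

end General

/-! ### The structured determinants `𝒟_I` -/

omit [DecidableEq κ] in
/-- A sum of naturals dominates the sum of its distinct values, which dominates
`0 + 1 + ⋯ + (#values - 1)`. [folklore] -/
theorem sum_range_card_image_le (m : κ → ℕ) :
    ∑ x ∈ range (Finset.univ.image m).card, x ≤ ∑ i, m i := by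
  refine (Laurent.sum_range_card_le_sum _).trans ?_
  rw [← Finset.sum_fiberwise_of_maps_to (g := m) (t := Finset.univ.image m)
    (fun i _ => Finset.mem_image_of_mem m (Finset.mem_univ i)) m]
  refine Finset.sum_le_sum fun v hv => ?_
  obtain ⟨i, -, rfl⟩ := Finset.mem_image.mp hv
  calc m i = ∑ i' ∈ {i}, m i' := by simp
    _ ≤ ∑ i' ∈ Finset.univ.filter (fun i' => m i' = m i), m i' :=
        Finset.sum_le_sum_of_subset_of_nonneg (by simp) fun _ _ _ => Nat.zero_le _

/-- **Vanishing at the origin** ([NesterenkoWaldschmidt1996, §3, proof of Lemma 3]). Columns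
`j ∈ I` structured, `g_{ij}(w) = φ_j^{(σ_i)}(ζ_i w)`, columns `j ∉ I` constant. If
`∑ k_i + ∑ σ_i < 0 + 1 + ⋯ + (|I| - 1)` then `det (∂^{k_i} g_{ij}(0)) = 0`: the structured
columns at `0` are `(ζ_i^{k_i} φ_j^{(σ_i + k_i)}(0))_i`, and `i ↦ σ_i + k_i` takes fewer than `|I|`
values, so these `|I|` columns are linearly dependent. [cite: NesterenkoWaldschmidt1996, §3 Lemma 3] -/
theorem det_deriv_structured_eq_zero (f : κ → ℂ → ℂ) (hf : ∀ j, Differentiable ℂ (f j))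
    (σ : κ → ℕ) (ζ : κ → ℂ) (I : Finset κ) {g : κ → κ → ℂ → ℂ}
    (hgI : ∀ i, ∀ j ∈ I, g i j = fun w => iteratedDeriv (σ i) (f j) (ζ i * w))
    (hgP : ∀ i, ∀ j ∉ I, ∃ c, g i j = fun _ => c) (k : κ → ℕ)
    (hk : (∑ i, k i) + (∑ i, σ i) < ∑ x ∈ range I.card, x) :
    Matrix.det (Matrix.of fun i j => iteratedDeriv (k i) (g i j) 0) = 0 := by
  classical
  set m : κ → ℕ := fun i => σ i + k i with hm
  set V := Finset.univ.image m with hV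
  -- fewer than `|I|` values
  have hVcard : V.card < I.card := by
    by_contra hle
    push Not at hle
    have h1 : ∑ x ∈ range I.card, x ≤ ∑ x ∈ range V.card, x :=
      Finset.sum_le_sum_of_subset_of_nonneg (Finset.range_subset_range.mpr hle) fun _ _ _ => Nat.zero_le _
    have h2 : ∑ x ∈ range V.card, x ≤ ∑ i, m i := sum_range_card_image_le m
    have h3 : ∑ i, m i = (∑ i, k i) + ∑ i, σ i := by
      rw [hm]; simp [Finset.sum_add_distrib, add_comm]
    omega
  -- the entries at `0`
  set F : κ → ℕ → ℂ := fun j n => iteratedDeriv n (f j) 0 with hF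
  have hentryI : ∀ i, ∀ j ∈ I, iteratedDeriv (k i) (g i j) 0 = ζ i ^ k i * F j (m i) := by
    intro i j hj
    rw [hgI i j hj, iteratedDeriv_comp_const_mul
      (((hf j).contDiff (n := ⊤)).differentiable_iteratedDeriv (σ i)
        (WithTop.coe_lt_top _)).contDiff (ζ i)]
    simp only [mul_zero, hF, hm]
    rw [iteratedDeriv_eq_iterate, iteratedDeriv_eq_iterate, iteratedDeriv_eq_iterate,
      ← Function.iterate_add_apply, Nat.add_comm]
  have hentryP : ∀ i, ∀ j ∉ I, k i ≠ 0 → iteratedDeriv (k i) (g i j) 0 = 0 := by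
    intro i j hj hki
    obtain ⟨c, hc⟩ := hgP i j hj
    rw [hc, iteratedDeriv_const, if_neg hki]
  -- a non-trivial relation between the structured columns
  set N : Matrix V I ℂ := Matrix.of fun v j => F j.1 v.1 with hN
  have hker : (Matrix.mulVecLin N).ker ≠ ⊥ := by
    refine LinearMap.ker_ne_bot_of_finrank_lt ?_
    rw [Module.finrank_fintype_fun_eq_card, Module.finrank_fintype_fun_eq_card]
    simpa using hVcard
  obtain ⟨c, hc, hc0⟩ := (Submodule.ne_bot_iff _).mp hker
  rw [LinearMap.mem_ker, Matrix.mulVecLin_apply] at hc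
  set cfull : κ → ℂ := fun j => if h : j ∈ I then c ⟨j, h⟩ else 0 with hcfull
  have hcfull0 : cfull ≠ 0 := by
    intro h
    apply hc0
    funext j
    have := congrFun h j.1
    simp only [hcfull, Pi.zero_apply, dif_pos j.2] at this
    exact this
  refine (Matrix.exists_mulVec_eq_zero_iff).mp ⟨cfull, hcfull0, ?_⟩
  funext i
  have hmi : m i ∈ V := Finset.mem_image_of_mem m (Finset.mem_univ i)
  have hci := congrFun hc ⟨m i, hmi⟩
  simp only [Matrix.mulVec, dotProduct, Pi.zero_apply, hN, Matrix.of_apply] at hci ⊢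
  calc ∑ j, iteratedDeriv (k i) (g i j) 0 * cfull j
      = ∑ j ∈ I, iteratedDeriv (k i) (g i j) 0 * cfull j := by
        refine (Finset.sum_subset (Finset.subset_univ I) fun j _ hj => ?_).symm
        simp [hcfull, dif_neg hj]
    _ = ∑ j : I, iteratedDeriv (k i) (g i j) 0 * cfull j := (Finset.sum_coe_sort I _).symm
    _ = ∑ j : I, ζ i ^ k i * (F j.1 (m i) * c j) := by
        refine Finset.sum_congr rfl fun j _ => ?_
        rw [hentryI i j.1 j.2]
        simp only [hcfull, dif_pos j.2]
        ring
    _ = 0 := by rw [← Finset.mul_sum, hci, mul_zero]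

/-- **Schwarz lemma for `𝒟_I`** ([NesterenkoWaldschmidt1996, §3]): with columns `j ∈ I` structured and
columns `j ∉ I` constant of size `≤ ε 𝔐`, `|ζ_i| ≤ r`, `E ≥ 1` and `|φ_j^{(σ_i)}| ≤ 𝔐` on
`|z| ≤ E r`: `|𝒟_I(1)| ≤ L! 𝔐^L ε^{L - |I|} / E^{(0+1+⋯+(|I|-1)) - ∑σ_i}`.
[cite: NesterenkoWaldschmidt1996, §3 Lemma 3] -/
theorem norm_det_structured_le (f : κ → ℂ → ℂ) (hf : ∀ j, Differentiable ℂ (f j))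
    (σ : κ → ℕ) (ζ : κ → ℂ) (I : Finset κ) {g : κ → κ → ℂ → ℂ}
    (hgI : ∀ i, ∀ j ∈ I, g i j = fun w => iteratedDeriv (σ i) (f j) (ζ i * w))
    (hgP : ∀ i, ∀ j ∉ I, ∃ c, g i j = fun _ => c)
    {r E 𝔐 ε : ℝ} (hE : 1 ≤ E) (hζ : ∀ i, ‖ζ i‖ ≤ r)
    (hfM : ∀ i j z, ‖z‖ ≤ E * r → ‖iteratedDeriv (σ i) (f j) z‖ ≤ 𝔐)
    (hPM : ∀ i, ∀ j ∉ I, ‖g i j 0‖ ≤ ε * 𝔐) :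
    ‖Matrix.det (Matrix.of fun i j => g i j 1)‖ ≤
      (Fintype.card κ).factorial * 𝔐 ^ Fintype.card κ * ε ^ (Fintype.card κ - I.card) /
        E ^ ((∑ x ∈ range I.card, x) - ∑ i, σ i) := by
  classical
  set L := Fintype.card κ with hL
  set T := (∑ x ∈ range I.card, x) - ∑ i, σ i with hT
  have hg : ∀ i j, Differentiable ℂ (g i j) := by
    intro i j
    by_cases hj : j ∈ I
    · rw [hgI i j hj]
      exact (((hf j).contDiff (n := ⊤)).differentiable_iteratedDeriv (σ i)
        (WithTop.coe_lt_top _)).comp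
        (differentiable_id.const_mul _)
    · obtain ⟨c, hc⟩ := hgP i j hj
      rw [hc]; exact differentiable_const _
  -- order of vanishing at `0`
  have hord : (T : ℕ∞) ≤ analyticOrderAt (fun w => Matrix.det (Matrix.of fun i j => g i j w)) 0 := by
    refine le_analyticOrderAt_det hg T fun k hk => ?_
    refine det_deriv_structured_eq_zero f hf σ ζ I hgI hgP k ?_
    rw [hT] at hk
    omega
  -- bound on the circle `|z| = E`
  have hE0 : 0 < E := by linarith
  set θ : ℝ := L.factorial * (𝔐 ^ L * ε ^ (L - I.card)) with hθ
  have hbound : ∀ z ∈ sphere (0 : ℂ) E, ‖Matrix.det (Matrix.of fun i j => g i j z)‖ ≤ θ := by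
    intro z hz
    have hz' : ‖z‖ = E := by simpa using hz
    have h := Laurent.norm_det_le_of_col_le (Matrix.of fun i j => g i j z)
      (C := fun j => if j ∈ I then 𝔐 else ε * 𝔐) (fun i j => by
        simp only [Matrix.of_apply]
        split_ifs with hj
        · rw [hgI i j hj]
          refine hfM i j _ ?_
          rw [norm_mul, hz', mul_comm]
          exact mul_le_mul_of_nonneg_left (hζ i) hE0.le
        · obtain ⟨c, hc⟩ := hgP i j hj
          have h0 := hPM i j hj
          rw [hc] at h0 ⊢
          exact h0)
    refine h.trans (le_of_eq ?_)
    rw [hθ, Finset.prod_ite, Finset.prod_const, Finset.prod_const]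
    have h1 : (Finset.univ.filter fun j => j ∈ I).card = I.card := by
      rw [Finset.filter_mem_eq_inter, Finset.univ_inter]
    have h2 : (Finset.univ.filter fun j => ¬ j ∈ I).card = L - I.card := by
      rw [Finset.filter_not, Finset.filter_mem_eq_inter, Finset.univ_inter, Finset.card_univ_sdiff]
    rw [h1, h2, mul_pow]
    have hIL : I.card ≤ L := by rw [hL]; exact Finset.card_le_univ I
    rw [show 𝔐 ^ L = 𝔐 ^ I.card * 𝔐 ^ (L - I.card) by rw [← pow_add, Nat.add_sub_cancel' hIL]]
    ring
  have hm : ∀ z ∈ sphere (0 : ℂ) E, E ^ T ≤ ‖∏ c ∈ ({0} : Finset ℂ), (z - c) ^ T‖ := by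
    intro z hz
    have hz' : ‖z‖ = E := by simpa using hz
    simp [hz']
  have hdiff : Differentiable ℂ (fun w => Matrix.det (Matrix.of fun i j => g i j w)) := by
    have h := differentiable_detDeriv hg 0
    simp only [Pi.zero_apply, iteratedDeriv_zero] at h
    exact h
  have key := Baker1975.Analytic.norm_le_of_analyticOrderAt hdiff ({0} : Finset ℂ) T
    (fun c hc => by rw [Finset.mem_singleton.mp hc]; exact hord) hE0 hbound (pow_pos hE0 T) hm
    (w := 1) (by simpa using hE)
  calc ‖Matrix.det (Matrix.of fun i j => g i j 1)‖
      ≤ θ / E ^ T * ‖∏ c ∈ ({0} : Finset ℂ), ((1 : ℂ) - c) ^ T‖ := key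
    _ = θ / E ^ T := by simp
    _ = (L.factorial : ℝ) * 𝔐 ^ L * ε ^ (L - I.card) / E ^ T := by rw [hθ]; ring

/-! ### Lemma 3 -/

/-- The exponent bookkeeping: for `i ≤ L`, `(0+⋯+(L-1)) ≤ L(L-i) + (0+⋯+(i-1))`. [folklore] -/
theorem sum_range_le_mul_add_sum_range {i L : ℕ} (hi : i ≤ L) :
    ∑ x ∈ range L, x ≤ L * (L - i) + ∑ x ∈ range i, x := by
  have h := Finset.sum_range_add_sum_Ico (fun x => x) hi
  have h2 : ∑ x ∈ Finset.Ico i L, x ≤ L * (L - i) := by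
    calc ∑ x ∈ Finset.Ico i L, x ≤ ∑ _x ∈ Finset.Ico i L, L :=
          Finset.sum_le_sum fun x hx => (Finset.mem_Ico.mp hx).2.le
      _ = L * (L - i) := by rw [Finset.sum_const, Nat.card_Ico, smul_eq_mul, mul_comm]
  omega

/-- **Analytic upper bound for interpolation determinants with derivatives and a perturbation**
([NesterenkoWaldschmidt1996, §3, Lemma 3], after Laurent 1989/1994). Let `φ_j` (`j ∈ κ`,
`|κ| = L`) be entire, `ζ_i` points with `|ζ_i| ≤ r`, `σ_i` orders, `E ≥ 1`, `0 ≤ ε` with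
`ε E^L ≤ 1`, `|φ_j^{(σ_i)}(z)| ≤ 𝔐` for `|z| ≤ E r` and `|p_{ij}| ≤ ε 𝔐`. Then
`|det (φ_j^{(σ_i)}(ζ_i) + p_{ij})| ≤ 2^L L! 𝔐^L E^{∑σ_i} / E^{0+1+⋯+(L-1)}`.
[cite: NesterenkoWaldschmidt1996, §3 Lemma 3] -/
theorem norm_det_interpolation_deriv_le (f : κ → ℂ → ℂ) (hf : ∀ j, Differentiable ℂ (f j))
    (σ : κ → ℕ) (ζ : κ → ℂ) (P : κ → κ → ℂ) {r E 𝔐 ε : ℝ} (hE : 1 ≤ E) (hζ : ∀ i, ‖ζ i‖ ≤ r)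
    (h𝔐 : 0 ≤ 𝔐) (hε : 0 ≤ ε) (hεE : ε * E ^ Fintype.card κ ≤ 1)
    (hfM : ∀ i j z, ‖z‖ ≤ E * r → ‖iteratedDeriv (σ i) (f j) z‖ ≤ 𝔐)
    (hPM : ∀ i j, ‖P i j‖ ≤ ε * 𝔐) :
    ‖Matrix.det (Matrix.of fun i j => iteratedDeriv (σ i) (f j) (ζ i) + P i j)‖ ≤
      2 ^ Fintype.card κ * (Fintype.card κ).factorial * 𝔐 ^ Fintype.card κ *
        E ^ (∑ i, σ i) / E ^ (∑ x ∈ range (Fintype.card κ), x) := by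
  classical
  set L := Fintype.card κ with hL
  have hE0 : 0 < E := by linarith
  -- Step 1: expansion by multilinearity in the columns
  set colA : κ → κ → ℂ := fun j i => iteratedDeriv (σ i) (f j) (ζ i) with hcolA
  set colP : κ → κ → ℂ := fun j i => P i j with hcolP
  have hexp : Matrix.det (Matrix.of fun i j => iteratedDeriv (σ i) (f j) (ζ i) + P i j) =
      ∑ I : Finset κ, Matrix.det (Matrix.of fun i j => if j ∈ I then colA j i else colP j i) := by
    have ht : (Matrix.of fun i j => iteratedDeriv (σ i) (f j) (ζ i) + P i j) =
        (Matrix.of (colA + colP)).transpose := by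
      ext i j; simp [hcolA, hcolP]
    rw [ht, Matrix.det_transpose]
    have hml := ((Matrix.detRowAlternating : (κ → ℂ) [⋀^κ]→ₗ[ℂ] ℂ) :
      MultilinearMap ℂ (fun _ : κ => κ → ℂ) ℂ).map_add_univ colA colP
    simp only [AlternatingMap.coe_multilinearMap] at hml
    change Matrix.detRowAlternating (colA + colP) = _
    rw [hml]
    refine Finset.sum_congr rfl fun I _ => ?_
    rw [← Matrix.det_transpose]
    congr 1
    ext i j
    simp only [Matrix.transpose_apply, Matrix.of_apply, Finset.piecewise]
    split_ifs <;> rfl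
  -- Step 2: each term
  have hterm : ∀ I : Finset κ,
      ‖Matrix.det (Matrix.of fun i j => if j ∈ I then colA j i else colP j i)‖ ≤
        L.factorial * 𝔐 ^ L * ε ^ (L - I.card) / E ^ ((∑ x ∈ range I.card, x) - ∑ i, σ i) := by
    intro I
    set g : κ → κ → ℂ → ℂ := fun i j =>
      if j ∈ I then (fun w => iteratedDeriv (σ i) (f j) (ζ i * w)) else fun _ => P i j with hg
    have hgI : ∀ i, ∀ j ∈ I, g i j = fun w => iteratedDeriv (σ i) (f j) (ζ i * w) := by
      intro i j hj; simp [hg, hj]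
    have hgP : ∀ i, ∀ j ∉ I, ∃ c, g i j = fun _ => c := by
      intro i j hj; exact ⟨P i j, by simp [hg, hj]⟩
    have h1 : (Matrix.of fun i j => if j ∈ I then colA j i else colP j i) =
        Matrix.of fun i j => g i j 1 := by
      ext i j
      simp only [Matrix.of_apply, hg, hcolA, hcolP]
      split_ifs <;> simp
    rw [h1]
    refine norm_det_structured_le f hf σ ζ I hgI hgP hE hζ hfM fun i j hj => ?_
    simp only [hg, if_neg hj]
    exact hPM i j
  -- Step 3: the exponents
  have hexpo : ∀ I : Finset κ,
      (L.factorial : ℝ) * 𝔐 ^ L * ε ^ (L - I.card) / E ^ ((∑ x ∈ range I.card, x) - ∑ i, σ i) ≤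
        L.factorial * 𝔐 ^ L * E ^ (∑ i, σ i) / E ^ (∑ x ∈ range L, x) := by
    intro I
    have hIL : I.card ≤ L := by rw [hL]; exact Finset.card_le_univ I
    rw [mul_div_assoc, mul_div_assoc]
    refine mul_le_mul_of_nonneg_left ?_ (by positivity)
    rw [div_le_div_iff₀ (by positivity) (by positivity)]
    -- `ε^{L-|I|} E^{ΣL} ≤ E^{Σσ} E^{T_I}`
    have hεpow : ε ^ (L - I.card) * E ^ (L * (L - I.card)) ≤ 1 := by
      rw [pow_mul, ← mul_pow]
      exact pow_le_one₀ (by positivity) hεE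
    have hnat : ∑ x ∈ range L, x ≤ L * (L - I.card) + (((∑ x ∈ range I.card, x) - ∑ i, σ i) + ∑ i, σ i) := by
      have := sum_range_le_mul_add_sum_range hIL
      omega
    calc ε ^ (L - I.card) * E ^ (∑ x ∈ range L, x)
        ≤ ε ^ (L - I.card) * E ^ (L * (L - I.card) + (((∑ x ∈ range I.card, x) - ∑ i, σ i) + ∑ i, σ i)) :=
          mul_le_mul_of_nonneg_left (pow_le_pow_right₀ hE hnat) (by positivity)
      _ = (ε ^ (L - I.card) * E ^ (L * (L - I.card))) *
            (E ^ (∑ i, σ i) * E ^ ((∑ x ∈ range I.card, x) - ∑ i, σ i)) := by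
          rw [pow_add, pow_add]; ring
      _ ≤ 1 * (E ^ (∑ i, σ i) * E ^ ((∑ x ∈ range I.card, x) - ∑ i, σ i)) :=
          mul_le_mul_of_nonneg_right hεpow (by positivity)
      _ = E ^ (∑ i, σ i) * E ^ ((∑ x ∈ range I.card, x) - ∑ i, σ i) := one_mul _
  -- Step 4: sum up
  rw [hexp]
  calc ‖∑ I : Finset κ, Matrix.det (Matrix.of fun i j => if j ∈ I then colA j i else colP j i)‖
      ≤ ∑ I : Finset κ, ‖Matrix.det (Matrix.of fun i j => if j ∈ I then colA j i else colP j i)‖ :=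
        norm_sum_le _ _
    _ ≤ ∑ _I : Finset κ, (L.factorial : ℝ) * 𝔐 ^ L * E ^ (∑ i, σ i) / E ^ (∑ x ∈ range L, x) :=
        Finset.sum_le_sum fun I _ => (hterm I).trans (hexpo I)
    _ = 2 ^ L * L.factorial * 𝔐 ^ L * E ^ (∑ i, σ i) / E ^ (∑ x ∈ range L, x) := by
        rw [Finset.sum_const, Finset.card_univ, Fintype.card_finset, nsmul_eq_mul]
        push_cast
        ring

end NW1996

end Literature.NumberTheory.Transcendental

end
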